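import Literature.Analysis.ODE.TameZoneTransport
import Literature.Geometry.Lorentzian.KerrSurfaceGravity

/-!
# Transport of the `η`-energy across a tame zone
# (stub `stub_tameZoneTransport`, E1 of the line `olver-dunster-uniform-reduction`)

Crux `PhaseMixingCapture.KappaExplicitWaveDecay` (stmt-FinalStateConjecture-10654), line
`olver-dunster-uniform-reduction`, stub E1 — the generic a priori lemma that carries the size of a
complex solution of `u″ = −φ u` (`φ` real, differentiable, piecewise monotone) across a zone on
which only `−η² ≤ φ ≤ Φ` is known (`0 < η`, `η² ≤ Φ`): the `η`-energy `E = η²‖u‖² + ‖u′‖²`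
changes by at most the factor `(Φ/η²)^{2k} · exp(2η (t k − t 0))` between ANY two points of
`[t 0, t k]`, `k` = number of monotone pieces `[t i, t (i+1)]`.

The statement is pure real/complex analysis and is proved in the Literature tree,
`Literature/Analysis/ODE/TameZoneTransport.lean` (sorry-free, Mathlib only):

* a COLLAR `|φ| ≤ η²` costs `exp(2η · length)` (Hartman's a priori bound in the `η`-weighted
  energy, `Literature.Analysis.ODE.zoneEnergy_le_zoneEnergy_mul_exp` of
  `TransitionZoneGrowth.lean`);
* a BLOCK `η² ≤ φ ≤ Φ` with `φ` monotone costs `(Φ/η²)²` (Sonin–Pólya energy / Sonin envelope,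
  `Literature.Analysis.ODE.soninEnergy_le_mul_ratio` of `SoninPiecewise.lean`, and
  `E ≤ φ‖u‖² + ‖u′‖² ≤ (Φ/η²) E`);
* on one monotone piece the two are chained through a junction `φ(s) = η²` (intermediate value
  theorem), and the pieces are chained by induction through the partition points
  (`Literature.Analysis.ODE.tameZone_transport`).

This file is the thin wrapper `stub_tameZoneTransport := tameZone_transport` with the registered
signature copied byte for byte from the skeleton.
-/

-- the doubled `FinalStateConjecture.FinalStateConjecture` path component trips dupNamespace
set_option linter.dupNamespace false

noncomputable section

namespace Summit.FinalStateConjecture.FinalStateConjecture.Theorems.KappaExplicitWaveDecay.OlverDunsterUniformReduction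

open Literature.Geometry.Lorentzian
open MeasureTheory Filter Set Complex
open scoped Topology Manifold ENNReal Classical

/-- **E1 · `stub_tameZoneTransport` — transport of the `η`-energy across a tame zone (generic
real ODE).** Let `u″ = −φu` on `[t 0, t k]` (complex `u`, real `φ` with a derivative), where `φ`
is monotone or antitone on each of the `k` consecutive pieces `[t i, t (i+1)]`, and
`−η² ≤ φ ≤ Φ` throughout (`0 < η`, `η² ≤ Φ`). Then for ANY two points `x, y` of the zone the
`η`-energy `E = η²‖u‖² + ‖u′‖²` satisfies `E(y) ≤ (Φ/η²)^{2k} · exp(2η (t k − t 0)) · E(x)`.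
Proof: `Literature.Analysis.ODE.tameZone_transport`. -/
theorem stub_tameZoneTransport :
    ∀ (k : ℕ) (t : ℕ → ℝ) (u u' : ℝ → ℂ) (φ φ' : ℝ → ℝ) (η Φ : ℝ),
      (∀ i < k, t i ≤ t (i + 1)) →
      (∀ x ∈ Icc (t 0) (t k), HasDerivAt u (u' x) x ∧ HasDerivAt u' (-((φ x : ℂ) * u x)) x) →
      (∀ x ∈ Icc (t 0) (t k), HasDerivAt φ (φ' x) x) →
      (∀ i < k, MonotoneOn φ (Icc (t i) (t (i + 1))) ∨ AntitoneOn φ (Icc (t i) (t (i + 1)))) →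
      0 < η → η ^ 2 ≤ Φ →
      (∀ x ∈ Icc (t 0) (t k), -η ^ 2 ≤ φ x ∧ φ x ≤ Φ) →
        ∀ x ∈ Icc (t 0) (t k), ∀ y ∈ Icc (t 0) (t k),
          η ^ 2 * ‖u y‖ ^ 2 + ‖u' y‖ ^ 2 ≤
            (Φ / η ^ 2) ^ (2 * k) * Real.exp (2 * η * (t k - t 0)) * (η ^ 2 * ‖u x‖ ^ 2 + ‖u' x‖ ^ 2) := by
  intro k t u u' φ φ' η Φ ht hu hφ hmono hη hΦ hbd x hx y hy
  exact Literature.Analysis.ODE.tameZone_transport t ht hu hφ hmono hη hΦ hbd hx hy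

end Summit.FinalStateConjecture.FinalStateConjecture.Theorems.KappaExplicitWaveDecay.OlverDunsterUniformReduction

end
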